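/-
Copyright (c) 2026 the pub-hodgecm-mathlib formalisation cell (harness21).  Prover seat hodgecm-mathlib-LH7-p02 (g6): LH4-plan (g7) WORD #10 DEAL (h) «LOCALFIELDS GATE (I4),
part L1» — the TRACE-FRAME (2-free) twin of ★ FILE 8 of the story `UnramifiedQuadraticNorm*` (F0P3b-p01 (g6) under A-p03 (g24)); census
`F0/P3c/LH7/LH7-p02/g6/h/CENSUS-h-ShiftPairsTrace.v1.LH7p02g6.md` sha16 10d40da9480eff08 (FINDINGS (h-1)∕(h-2)); 2026-09-02.
-/
import Literature.NumberTheory.LocalFields.UnramifiedQuadraticNormResidueShiftPairs       -- ★ FILE 8 (brings FILE 7 `natCard_norm_congr_shift`, FILES 1–6, `natCard_subtype_comp_eq_mul`)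
import HarnessLib

/-!
# The pair count of Flicker's Prop. 13, cases (c)∕(e), in the TRACE FRAME (every residue characteristic): `#{(u, y) : σ̄y = y, N((uσ̄u)⁻¹ + e + y·g) ≡ e² − 1 (mod 𝔪^j)}`
# `= q^{m−1}(q+1) · (q+1)q^{2m−j−1}` — FILE 8′ of the story `UnramifiedQuadraticNorm*`
(Flicker (1998), *Elementary proof of the fundamental lemma for a unitary group*, Prop. 13 p. 93, cases (c)∕(e); Serre, *Local Fields*, V §2)

Topic `NumberTheory/LocalFields`, namespace `Literature.NumberTheory.LocalFields.UnramifiedQuadraticNorm`.  THEOREMS ONLY: no definition, no named fact, no instance, no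
notation, no `sorry`; kernel lane `--supports stmt-HodgeConjecture-24833`.  Cell `pub/hodgecm-mathlib` (D-0151), crux H413; LH4-plan (g7) WORD #10 DEAL (h) «LOCALFIELDS GATE
(I4), part L1» of the LAYER C (trace-frame) column — the 2-free residue-pair counts read by the (C3e) twins of ★ `Automorphic/UnitaryThreeBorelCosetCountJZero{Near,High}`
(F0P3a-p09's CENSUS-C3 9b5d3560 §0 (γ) ∕ §4 (I4)).  HC_CM is proved only modulo the 7 printed citations (2 remaining named inputs: hLiu418 = stmt-HodgeConjecture-24832,
h413 = stmt-HodgeConjecture-24833) until rung 0 closes; this file is elementary local-ring counting, count-neutral ((D-UNR) stays PRINT by D74′), and proves no letter.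

WHY A TRACE FRAME (census FINDINGS (h-1)∕(h-2)).  ★ FILE 8∕10 count pairs `(u, x)` with `x̄` ANTI-FIXED (`σ̄x = −x`) and split every class `z ∈ A = R ⧸ 𝔪^m` as FIXED + ANTI-FIXED
(`½(z + σ̄z) + ½(z − σ̄z)`) — which needs `2 ∈ Rˣ` three times (the splitting, its uniqueness `2F = 2F′ ⇒ F = F′`, and the unit claim «`(1−x̄)+(1+x̄) = 2`»).  At a place of
residue characteristic `2` that count is NOT the printed value (the anti-fixed line `A₀·(σa − a)` only spans, with `A₀`, the image of the ORDER `R^σ + 2R` of conductor `2`;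
brute force over `(ℚ₂, ℚ₂(ζ₃))` in the census).  The residue-characteristic-free currency is the FRAME LINE: for any `g ∈ R` with `σg − g ∈ Rˣ` (the section's own `a`; or the
trace literal's `b`, `b + σb = 1`, when `|σb − b| = 1`) one has `R = R^σ ⊕ R^σ·g` and `A = A₀ ⊕ A₀·ḡ` UNIQUELY with NO division by `2` (`y := (σ̄z − z)(σ̄ḡ − ḡ)⁻¹`,
`F := z − yḡ`), and the pairs to count are `(u, y)` with `ȳ` FIXED, `z = (uσ̄u)⁻¹ + ē + ȳ·ḡ`.  The unit claim «the `A₀`-coordinate of `z` minus `ē` is a unit whenever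
`N z ≡ e² − 1 (mod 𝔪^j)`» then holds in EVERY characteristic as soon as `e² − 1 ∈ 𝔪` (i.e. `1 ≤ ℓ`): if `F ≡ e` then `N z − (e² − 1) ≡ N(1 + e·y·g) (mod 𝔪)`, so
`N(1 + eyg) ∈ 𝔪`, hence (prime ideal + `σ̄`) `1 + eyg, 1 + ey·σ̄g ∈ 𝔪`, hence `ey(σ̄g − g) ∈ 𝔪`, `ey ∈ 𝔪`, `1 ∈ 𝔪` — absurd.  With that, the ★ route runs verbatim
(norm fibres ★ `natCard_norm_fibre_quotient_pow`, `z`-counts ★ FILE 7∕9) and the RHS is the PRINTED value.  The binder `1 ≤ ℓ` is NEW and NECESSARY at `2 ∉ Rˣ` (census: at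
`ℓ = 0` the count is `2∕3` of the printed value over `ℚ₂(ζ₃)` in both frames; in cases (c)∕(e) `2ℓ = M − N > 0`).

* §1 (any commutative local ring `A` with an involution `τ` and a frame class `g`, `τg − g ∈ Aˣ`): `map_inv_frame_unit` (bookkeeping), **`fixed_add_mul_frame_inj`** (uniqueness of
  `F + y·g`), **`exists_fixed_add_mul_frame_eq`** (existence: `A = A^τ ⊕ A^τ·g`), **`isUnit_fixed_sub_of_norm_sub_frame`** (the unit claim, `e² − 1 ∉ Aˣ`).
* §2 (complete DVR `R`, `|R ⧸ 𝔪| = q²`, involution `σ` with an antisymmetric unit `σa − a`; NO `2 ∈ Rˣ`): **`natCard_pairs_norm_congr_shift_frame`** (`2ℓ < j ≤ m`, `1 ≤ ℓ`; = ★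
  FILE 8 `natCard_pairs_norm_congr_shift` with `σ̄x = −x ↦ σ̄y = y`, `+ x ↦ + y·ḡ`, `h2 ↦ hg + hℓ`, RHS verbatim).  The precision-beyond-the-level twin (`2ℓ < j ≤ m + ℓ`, `∃ w`-lift
  predicate; ★ FILE 10) is the sequel file `UnramifiedQuadraticNormResidueShiftHighPairsTrace` (400-line rule).
The tame ★ heads are NOT restated (they remain the `2 ∈ Rˣ`, anti-fixed-currency statements, valid there for `ℓ = 0` too).

## References
* [Flicker1998UnitaryFL] Y. Z. Flicker, *Elementary proof of the fundamental lemma for a unitary group*, Canad. J. Math. 50 (1998), 74–98: Prop. 13 p. 93 (cases (c)∕(e)).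
* [Serre1979] J.-P. Serre, *Local Fields*, GTM 67 (1979), Ch. V §2 Prop. 2–3 (norms of units in the unramified case, all residue characteristics).
-/

set_option autoImplicit false

namespace Literature.NumberTheory.LocalFields.UnramifiedQuadraticNorm

open Literature.LinearAlgebra.Matrix.HermitianFormsHensel Literature.NumberTheory.GaloisRepresentations IsLocalRing

universe u

variable {R : Type u} [CommRing R] (σ : R →+* R)

/-! ## §1 The frame splitting `A = A^τ ⊕ A^τ·g` and the unit claim, in a local ring with an involution — no `2` -/

section Local

variable {A : Type u} [CommRing A] (τ : A →+* A) (hτ : ∀ a, τ (τ a) = a) {g : A} (hg : IsUnit (τ g - g))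

/-- `τ` of the inverse of a unit `d` with `τ d = −d` is `−d⁻¹` (bookkeeping for the frame unit `τg − g`). [cite: Serre1979, Ch. V §2] -/
theorem map_inv_frame_unit (d : Aˣ) (hd : τ (d : A) = -d) : τ (↑d⁻¹ : A) = -↑d⁻¹ := by
  have h1 : τ (↑d⁻¹ : A) * τ (d : A) = 1 := by rw [← map_mul, Units.inv_mul, map_one]
  rw [hd] at h1
  have h2 : τ (↑d⁻¹ : A) = τ ↑d⁻¹ * (-(d : A)) * (-↑d⁻¹) := by
    rw [mul_assoc, neg_mul_neg, Units.mul_inv, mul_one]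
  rw [h2, h1, one_mul]

include hg in
/-- **Uniqueness of the frame splitting** `F + y·g` with `τF = F`, `τy = y` (apply `τ` and subtract: `(y − y′)(τg − g) = 0`, and `τg − g` is a unit).  No `2`.
[cite: Serre1979, Ch. V §2] -/
theorem fixed_add_mul_frame_inj {F F' y y' : A} (hF : τ F = F) (hF' : τ F' = F') (hy : τ y = y) (hy' : τ y' = y')
    (h : F + y * g = F' + y' * g) : F = F' ∧ y = y' := by
  have hτ' : F + y * τ g = F' + y' * τ g := by
    have := congrArg τ h
    rw [map_add, map_add, map_mul, map_mul, hF, hF', hy, hy'] at this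
    exact this
  have hy0 : (y - y') * (τ g - g) = 0 := by linear_combination hτ' - h
  have hyy : y = y' := sub_eq_zero.1 ((hg.mul_left_eq_zero).1 hy0)
  refine ⟨?_, hyy⟩
  rw [hyy] at h
  exact add_right_cancel h

include hτ hg in
/-- **Existence of the frame splitting**: every `z ∈ A` is `F + y·g` with `τF = F`, `τy = y` — `y := (τz − z)(τg − g)⁻¹`, `F := z − y·g`.  No `2`: this is the coordinate
form of `R = R^σ ⊕ R^σ·g` for a frame element with `σg − g` a unit (unramified situation). [cite: Serre1979, Ch. V §2] -/
theorem exists_fixed_add_mul_frame_eq (z : A) : ∃ F y : A, τ F = F ∧ τ y = y ∧ z = F + y * g := by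
  obtain ⟨d, hd⟩ := hg
  have hτd : τ (d : A) = -d := by rw [hd, map_sub, hτ]; ring
  have hτdi : τ (↑d⁻¹ : A) = -↑d⁻¹ := map_inv_frame_unit τ d hτd
  set y : A := (τ z - z) * ↑d⁻¹ with hy
  have hτy : τ y = y := by
    rw [hy, map_mul, map_sub, hτ, hτdi]; ring
  refine ⟨z - y * g, y, ?_, hτy, by ring⟩
  rw [map_sub, map_mul, hτy]
  -- `τz − y·τg = z − y·g` ⟺ `(τz − z) = y(τg − g) = (τz − z)d⁻¹·d`
  have hyd : y * (τ g - g) = τ z - z := by rw [hy, ← hd, mul_assoc, Units.inv_mul, mul_one]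
  linear_combination -hyd

include hτ hg in
/-- **The fixed coordinate minus `e` is a unit** when `N(z) − (e² − 1)` is a non-unit, `z = F + y·g` in the frame splitting, `e` `τ`-fixed with `e² − 1` a NON-UNIT (local ring `A`,
involution `τ`, frame unit `τg − g`; EVERY characteristic): if `F − e` were a non-unit then `N z − (e² − 1) ≡ N(1 + e·y·g) (mod 𝔪)`, so `(1 + eyg)·τ(1 + eyg) ∈ 𝔪`, whence both
factors are in `𝔪` (prime ideal, `τ`-stable), whence `ey(τg − g) ∈ 𝔪`, `ey ∈ 𝔪`, and `1 = (1 + eyg) − ey·g ∈ 𝔪`.  Trace-frame twin of ★ `isUnit_fixed_sub_of_norm_sub` (there: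
anti-fixed `x`, `(1−x)+(1+x) = 2`). [cite: Flicker1998UnitaryFL, Prop. 13 p. 93] -/
theorem isUnit_fixed_sub_of_norm_sub_frame [IsLocalRing A] {e F y : A} (hτe : τ e = e) (he1 : ¬ IsUnit (e ^ 2 - 1))
    (hF : τ F = F) (hy : τ y = y) (hN : ¬ IsUnit ((F + y * g) * τ (F + y * g) - (e ^ 2 - 1))) : IsUnit (F - e) := by
  by_contra hfe
  have hmem : F - e ∈ maximalIdeal A := (mem_maximalIdeal _).2 hfe
  have he1m : e ^ 2 - 1 ∈ maximalIdeal A := (mem_maximalIdeal _).2 he1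
  have hNmem : (F + y * g) * τ (F + y * g) - (e ^ 2 - 1) ∈ maximalIdeal A := (mem_maximalIdeal _).2 hN
  -- `N(1 + e y g) = N z − (e² − 1) − [(F − e)(F + e + y(g + τg)) − (e² − 1)·y²·g·τg]`
  have hkey : (1 + e * y * g) * τ (1 + e * y * g) =
      ((F + y * g) * τ (F + y * g) - (e ^ 2 - 1)) - ((F - e) * (F + e + y * (g + τ g)) - (e ^ 2 - 1) * (y ^ 2 * (g * τ g))) := by
    simp only [map_add, map_mul, map_one, hτe, hF, hy]
    ring
  have hN1 : (1 + e * y * g) * τ (1 + e * y * g) ∈ maximalIdeal A := by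
    rw [hkey]
    exact Ideal.sub_mem _ hNmem (Ideal.sub_mem _ (Ideal.mul_mem_right _ _ hmem) (Ideal.mul_mem_right _ _ he1m))
  have hτnu : ∀ w : A, ¬ IsUnit w → ¬ IsUnit (τ w) := fun w hw hu => hw (by have h := hu.map τ; rwa [hτ] at h)
  -- both factors lie in `𝔪`
  have hboth : 1 + e * y * g ∈ maximalIdeal A ∧ τ (1 + e * y * g) ∈ maximalIdeal A := by
    rcases Ideal.IsPrime.mem_or_mem (IsLocalRing.maximalIdeal.isMaximal A).isPrime hN1 with h1 | h1
    · exact ⟨h1, (mem_maximalIdeal _).2 (hτnu _ ((mem_maximalIdeal _).1 h1))⟩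
    · refine ⟨?_, h1⟩
      have := hτnu _ ((mem_maximalIdeal _).1 h1)
      rw [hτ] at this
      exact (mem_maximalIdeal _).2 this
  -- `e y (τg − g) ∈ 𝔪`, so `e y ∈ 𝔪`
  have hdiff : e * y * (τ g - g) ∈ maximalIdeal A := by
    have h : e * y * (τ g - g) = τ (1 + e * y * g) - (1 + e * y * g) := by
      simp only [map_add, map_mul, map_one, hτe, hy]; ring
    rw [h]
    exact Ideal.sub_mem _ hboth.2 hboth.1
  have hey : e * y ∈ maximalIdeal A := by
    obtain ⟨d, hd⟩ := hg
    have : e * y = e * y * (τ g - g) * ↑d⁻¹ := by rw [← hd, mul_assoc, Units.mul_inv, mul_one]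
    rw [this]
    exact Ideal.mul_mem_right _ _ hdiff
  -- `1 = (1 + e y g) − (e y) g ∈ 𝔪`
  have h1 : (1 : A) ∈ maximalIdeal A := by
    have : (1 : A) = (1 + e * y * g) - e * y * g := by ring
    rw [this]
    exact Ideal.sub_mem _ hboth.1 (Ideal.mul_mem_right _ _ hey)
  exact (mem_maximalIdeal _).1 h1 isUnit_one

end Local

/-! ## §2 The pair counts in the frame currency (no `2 ∈ Rˣ`) -/

section Count

variable [IsDomain R] [IsDiscreteValuationRing R] [Finite (ResidueField R)] [IsAdicComplete (maximalIdeal R) R]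
  (hσ : ∀ a, σ (σ a) = a) {a : R} (ha : IsUnit (σ a - a)) {q : ℕ} (hq : Nat.card (ResidueField R) = q ^ 2) {g : R} (hg : IsUnit (σ g - g))

include ha hq hg in
/-- **THE PAIR COUNT OF PROP. 13, CASES (c)∕(e), IN THE FRAME CURRENCY — EVERY RESIDUE CHARACTERISTIC** (`ρ_m`-currency): for `1 ≤ ℓ`, `2ℓ < j ≤ m`, `e ∈ R^σ` with
`e² − 1 = ϖ^{2ℓ}γ` (`γ ∈ (R^σ)^×`, `ϖ` a `σ`-fixed uniformiser) and a frame element `g` (`σg − g ∈ Rˣ`),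
`#{(u, y) ∈ (R ⧸ 𝔪^m)² : u ∈ (R⧸𝔪^m)^×, σ̄y = y, N((uσ̄u)⁻¹ + ē + y·ḡ) ≡ ϖ^{2ℓ}γ (mod 𝔪^j)} = q^{m−1}(q+1) · (q^{(m−ℓ)−(j−2ℓ)} · q^{m−ℓ−1}(q+1))` — the ★ FILE 8 value VERBATIM: the map
`(u,y) ↦ z = (uσ̄u)⁻¹ + ē + y·ḡ` has norm-fibre fibres (§1 uniqueness of the frame splitting) over exactly the classes counted by ★ `natCard_norm_congr_shift` (§1 existence of the
splitting + the unit claim, which needs `e² − 1 ∈ 𝔪`, i.e. `1 ≤ ℓ`).  Trace-frame twin of ★ `natCard_pairs_norm_congr_shift (h2)`. [cite: Flicker1998UnitaryFL, Prop. 13 p. 93]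
[cite: Serre1979, Ch. V §2 Prop. 3] -/
theorem natCard_pairs_norm_congr_shift_frame {p : R} (hp : Irreducible p) (hσp : σ p = p) {m j ℓ : ℕ} (hm : 1 ≤ m) (hℓ : 1 ≤ ℓ) (hj : 2 * ℓ < j) (hjm : j ≤ m)
    {e γ : R} (hσe : σ e = e) (hγ : IsUnit γ) (hσγ : σ γ = γ) (hec : e ^ 2 - 1 = p ^ (2 * ℓ) * γ) :
    Nat.card {uy : (R ⧸ maximalIdeal R ^ m) × (R ⧸ maximalIdeal R ^ m) // IsUnit uy.1 ∧
      Ideal.quotientMap (maximalIdeal R ^ m) σ (maximalIdeal_pow_le_comap σ hσ m) uy.2 = uy.2 ∧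
      Ideal.Quotient.factor (Ideal.pow_le_pow_right hjm)
        ((Ring.inverse (uy.1 * Ideal.quotientMap (maximalIdeal R ^ m) σ (maximalIdeal_pow_le_comap σ hσ m) uy.1) +
            Ideal.Quotient.mk (maximalIdeal R ^ m) e + uy.2 * Ideal.Quotient.mk (maximalIdeal R ^ m) g) *
          Ideal.quotientMap (maximalIdeal R ^ m) σ (maximalIdeal_pow_le_comap σ hσ m)
            (Ring.inverse (uy.1 * Ideal.quotientMap (maximalIdeal R ^ m) σ (maximalIdeal_pow_le_comap σ hσ m) uy.1) +
              Ideal.Quotient.mk (maximalIdeal R ^ m) e + uy.2 * Ideal.Quotient.mk (maximalIdeal R ^ m) g)) =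
        Ideal.Quotient.mk (maximalIdeal R ^ j) (p ^ (2 * ℓ) * γ)} =
      (q ^ (m - 1) * (q + 1)) * (q ^ ((m - ℓ) - (j - 2 * ℓ)) * (q ^ ((m - ℓ) - 1) * (q + 1))) := by
  classical
  haveI := CompleteLocalRing.finite_quotient_maximalIdeal_pow (R := R) m
  set A := R ⧸ maximalIdeal R ^ m with hA
  set τ := Ideal.quotientMap (maximalIdeal R ^ m) σ (maximalIdeal_pow_le_comap σ hσ m) with hτ
  set φ := Ideal.Quotient.factor (S := maximalIdeal R ^ m) (T := maximalIdeal R ^ j) (Ideal.pow_le_pow_right hjm) with hφ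
  have hττ : ∀ z, τ (τ z) = z := quotientMap_quotientMap σ hσ m
  have hτmk : ∀ w : R, τ (Ideal.Quotient.mk _ w) = Ideal.Quotient.mk _ (σ w) := fun w => Ideal.quotientMap_mk
  haveI : Nontrivial A := nontrivial_quotient_pow (R := R) hm
  haveI : IsLocalRing A := IsLocalRing.of_surjective' (Ideal.Quotient.mk (maximalIdeal R ^ m)) Ideal.Quotient.mk_surjective
  -- the frame class `ḡ` and its unit `τḡ − ḡ`
  set gA : A := Ideal.Quotient.mk _ g with hgA
  have hgAu : IsUnit (τ gA - gA) := by
    have h := hg.map (Ideal.Quotient.mk (maximalIdeal R ^ m))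
    rwa [map_sub, ← hτmk] at h
  have hτinv : ∀ w : Aˣ, τ (w : A) = w → τ (↑w⁻¹ : A) = ↑w⁻¹ := fun w hw => by
    have h1 : τ (↑w⁻¹ : A) * (w : A) = 1 := by rw [← hw, ← map_mul, Units.inv_mul, map_one]
    calc τ (↑w⁻¹ : A) = τ ↑w⁻¹ * ((w : A) * ↑w⁻¹) := by rw [Units.mul_inv, mul_one]
      _ = ↑w⁻¹ := by rw [← mul_assoc, h1, one_mul]
  have hq0 : 0 < q := by
    rcases Nat.eq_zero_or_pos q with h0 | h0
    · exfalso
      have h1 : 0 < Nat.card (ResidueField R) := Nat.card_pos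
      rw [hq, h0] at h1; simp at h1
    · exact h0
  set eA : A := Ideal.Quotient.mk _ e with heA
  have hτe : τ eA = eA := by rw [heA, hτmk, hσe]
  -- `ē² − 1` is a non-unit (`1 ≤ ℓ`)
  have he1 : ¬ IsUnit (eA ^ 2 - 1) := by
    intro hu
    have hcl : eA ^ 2 - 1 = Ideal.Quotient.mk (maximalIdeal R ^ m) (p ^ (2 * ℓ) * γ) := by
      rw [← hec, map_sub, map_pow, map_one, heA]
    rw [hcl] at hu
    have hu' : IsUnit (p ^ (2 * ℓ) * γ) := isUnit_of_isUnit_mk_pow (R := R) hm hu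
    have hpu : IsUnit (p ^ (2 * ℓ)) := isUnit_of_mul_isUnit_left hu'
    exact hp.not_isUnit ((isUnit_pow_iff (by omega)).1 hpu)
  -- the norm, the map `Z`, the predicate `G`
  let Nm : A → A := fun u => u * τ u
  have hNfix : ∀ u, τ (Nm u) = Nm u := fun u => by simp only [Nm, map_mul, hττ, mul_comm]
  let α := {uy : A × A // IsUnit uy.1 ∧ τ uy.2 = uy.2}
  let Z : α → A := fun w => Ring.inverse (Nm w.1.1) + eA + w.1.2 * gA
  let G : A → Prop := fun z => φ (z * τ z) = Ideal.Quotient.mk (maximalIdeal R ^ j) (p ^ (2 * ℓ) * γ)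
  haveI : Finite α := Subtype.finite
  -- Step 0: reshuffle to `{w : α // G (Z w)}`
  have e0 : {uy : A × A // IsUnit uy.1 ∧ τ uy.2 = uy.2 ∧ G (Ring.inverse (Nm uy.1) + eA + uy.2 * gA)} ≃ {w : α // G (Z w)} :=
    { toFun := fun w => ⟨⟨w.1, w.2.1, w.2.2.1⟩, w.2.2.2⟩
      invFun := fun w => ⟨w.1.1, w.1.2.1, w.1.2.2, w.2⟩
      left_inv := fun w => rfl
      right_inv := fun w => rfl }
  rw [Nat.card_congr e0]
  -- fixed parts: `Ring.inverse (Nm u) + e` is `τ`-fixed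
  have hfixZ : ∀ w : α, τ (Ring.inverse (Nm w.1.1) + eA) = Ring.inverse (Nm w.1.1) + eA := fun w => by
    rw [map_add, hτe]
    congr 1
    have hu : IsUnit (Nm w.1.1) := w.2.1.mul (w.2.1.map τ)
    rw [← hu.unit_spec, Ring.inverse_unit]
    exact hτinv hu.unit (by rw [hu.unit_spec]; exact hNfix _)
  -- Step 1: fibres of `Z` are norm fibres
  have hfibre : ∀ z ∈ Set.range Z, Nat.card {w : α // Z w = z} = q ^ (m - 1) * (q + 1) := by
    rintro _ ⟨w₀, rfl⟩
    obtain ⟨⟨u₀, y₀⟩, hu₀, hy₀⟩ := w₀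
    have hN₀ : IsUnit (Nm u₀) := hu₀.mul (hu₀.map τ)
    -- a σ-fixed unit lift of `Nm u₀`
    obtain ⟨v, hv⟩ := Ideal.Quotient.mk_surjective u₀
    have hvu : IsUnit v := isUnit_of_isUnit_mk_pow (R := R) hm (by rw [hv]; exact hu₀)
    have hr : Ideal.Quotient.mk (maximalIdeal R ^ m) (v * σ v) = Nm u₀ := by
      show _ = u₀ * τ u₀; rw [← hv, hτmk, map_mul]
    have hrunit : IsUnit (v * σ v) := hvu.mul (hvu.map σ)
    have hσr : σ (v * σ v) = v * σ v := by rw [map_mul, hσ, mul_comm]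
    rw [← natCard_norm_fibre_quotient_pow σ hσ ha hq hm hrunit hσr]
    refine Nat.card_congr
      { toFun := fun w => ⟨w.1.1.1, ?_⟩
        invFun := fun u => ⟨⟨(u.1, y₀), ?_, hy₀⟩, ?_⟩
        left_inv := fun w => ?_
        right_inv := fun u => rfl }
    · -- `Z w = Z w₀` forces `Nm w.u = Nm u₀`
      have h := w.2
      change Ring.inverse (Nm w.1.1.1) + eA + w.1.1.2 * gA = Ring.inverse (Nm u₀) + eA + y₀ * gA at h
      obtain ⟨hF, -⟩ := fixed_add_mul_frame_inj τ hgAu (hfixZ w.1) (hfixZ ⟨(u₀, y₀), hu₀, hy₀⟩) w.1.2.2 hy₀ h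
      have hinv : Ring.inverse (Nm w.1.1.1) = Ring.inverse (Nm u₀) := add_right_cancel hF
      have hNw : IsUnit (Nm w.1.1.1) := w.1.2.1.mul (w.1.2.1.map τ)
      have key : Nm w.1.1.1 = Nm u₀ := by
        rw [← Ring.inverse_inverse hNw, hinv, Ring.inverse_inverse hN₀]
      show w.1.1.1 * τ w.1.1.1 = Ideal.Quotient.mk _ (v * σ v)
      rw [hr]; exact key
    · -- a norm-fibre element is a unit
      have h : u.1 * τ u.1 = Nm u₀ := u.2.trans hr
      exact isUnit_of_mul_isUnit_left (h ▸ hN₀)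
    · show Ring.inverse (u.1 * τ u.1) + eA + y₀ * gA = Ring.inverse (Nm u₀) + eA + y₀ * gA
      have h : u.1 * τ u.1 = Nm u₀ := u.2.trans hr
      rw [h]
    · apply Subtype.ext; apply Subtype.ext
      have h := w.2
      change Ring.inverse (Nm w.1.1.1) + eA + w.1.1.2 * gA = Ring.inverse (Nm u₀) + eA + y₀ * gA at h
      obtain ⟨-, hY⟩ := fixed_add_mul_frame_inj τ hgAu (hfixZ w.1) (hfixZ ⟨(u₀, y₀), hu₀, hy₀⟩) w.1.2.2 hy₀ h
      exact Prod.ext rfl hY.symm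
  rw [Literature.NumberTheory.Automorphic.UnitaryGroup.natCard_subtype_comp_eq_mul Z G _ hfibre]
  congr 1
  -- Step 2: every `z` with `G z` is in the range of `Z`
  have hrange : ∀ z, G z → z ∈ Set.range Z := by
    intro z hz
    obtain ⟨F, Y, hFfix, hYfix, hzFY⟩ := exists_fixed_add_mul_frame_eq τ hττ hgAu z
    -- the fixed coordinate minus `e` is a unit
    have hGz : ¬ IsUnit ((F + Y * gA) * τ (F + Y * gA) - (eA ^ 2 - 1)) := by
      rw [← hzFY]
      intro hu
      have hj1 : 1 ≤ j := by omega
      haveI : Nontrivial (R ⧸ maximalIdeal R ^ j) := nontrivial_quotient_pow (R := R) hj1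
      have hzero : φ (z * τ z - (eA ^ 2 - 1)) = 0 := by
        rw [map_sub, hz, heA, map_sub, map_pow, map_one, hφ, Ideal.Quotient.factor_mk, ← map_pow, ← map_one (Ideal.Quotient.mk _), ← map_sub, ← hec, sub_self]
      exact not_isUnit_zero (hzero ▸ hu.map φ)
    have hFe : IsUnit (F - eA) := isUnit_fixed_sub_of_norm_sub_frame τ hττ hgAu hτe he1 hFfix hYfix hGz
    -- `n₁ := (F − e)⁻¹`, a fixed unit; pick `u` with `Nm u = n₁`
    set n₁ : A := ↑hFe.unit⁻¹ with hn₁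
    have hn₁fix : τ n₁ = n₁ := by
      have h1 : τ (F - eA) = F - eA := by rw [map_sub, hFfix, hτe]
      rw [hn₁]; exact hτinv hFe.unit (by rw [hFe.unit_spec]; exact h1)
    obtain ⟨r₀, hr₀⟩ := Ideal.Quotient.mk_surjective n₁
    have hmem : σ r₀ - r₀ ∈ maximalIdeal R ^ m := by
      rw [← Ideal.Quotient.eq_zero_iff_mem, map_sub, sub_eq_zero, ← hτmk, hr₀, hn₁fix]
    obtain ⟨r, hrfix, hrr⟩ := exists_fixed_sub_mem σ hσ ha hmem
    have hrn : Ideal.Quotient.mk (maximalIdeal R ^ m) r = n₁ := by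
      rw [← hr₀, Ideal.Quotient.eq]; exact hrr
    have hru : IsUnit r := isUnit_of_isUnit_mk_pow (R := R) hm (by rw [hrn, hn₁]; exact Units.isUnit _)
    have hpos : 0 < Nat.card {u : A // u * τ u = Ideal.Quotient.mk _ r} := by
      rw [natCard_norm_fibre_quotient_pow σ hσ ha hq hm hru hrfix]; exact Nat.mul_pos (pow_pos hq0 _) (Nat.succ_pos q)
    obtain ⟨⟨u, hu⟩⟩ := Nat.card_pos_iff.1 hpos |>.1
    rw [hrn] at hu
    have huunit : IsUnit u := isUnit_of_mul_isUnit_left (by rw [show u * τ u = n₁ from hu, hn₁]; exact Units.isUnit _)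
    refine ⟨⟨(u, Y), huunit, hYfix⟩, ?_⟩
    show Ring.inverse (u * τ u) + eA + Y * gA = z
    rw [show u * τ u = n₁ from hu, hn₁, Ring.inverse_unit, inv_inv, hFe.unit_spec, sub_add_cancel, hzFY]
  rw [Nat.card_congr (Equiv.subtypeEquivRight fun z => (and_iff_right_of_imp (hrange z) : z ∈ Set.range Z ∧ G z ↔ G z))]
  -- Step 3: the `z`-count
  exact natCard_norm_congr_shift σ hσ ha hq hp hσp hj hjm hγ hσγ

end Count

end Literature.NumberTheory.LocalFields.UnramifiedQuadraticNorm
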